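import Summits.KontsevichZagierPeriods.KontsevichZagierPeriods.Theorems.LinRedNormalFormHoffmanSpanInKZEdsDSLeafOfOddDet
import Summits.KontsevichZagierPeriods.KontsevichZagierPeriods.Theorems.FurushoPentagonKernelModuloPeriodConjectureLeafOfCheckBlocksGC
import HarnessLib

/-!
# Crux `LinRedNormalForm.HoffmanSpanInKZ` (stmt-KontsevichZagierPeriods-15044), line `eds-ds`:
# generic block masters (plain, grouped, mixed, grouped-compacted blocks)

Line `eds-ds` (lead c3). Generic twins of the block masters of the `LinEDS` soundness chain (route
FurushoPentagon, crux stmt-15058, `…LeafOfCheckBlocks*`): from a chain of kernel-certified depth blocks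
(`LinEDS.checkBlock` / `checkBlockG` / `checkBlockGC`) to the Hoffman expansion of every admissible index of weight `k` — here at
every group-like series `φ` over a commutative `ℚ`-algebra with `c_y(φ) = 0` ON WHICH THE VALID ROWS OF
WEIGHT `k` VANISH, instead of at every group-like pentagon solution (the pentagon enters the original chain
only through E5; the generic cores are `stub_leafRows_of_oddDet(Sum)`, file `…EdsDSLeafOfOddDet`). The
block bookkeeping (block lower-triangular determinant with odd diagonal blocks, columns covered by the
chain, valid names) is reused BY NAME from the FurushoPentagon files; only the final master statements are
re-proved, verbatim, against the generic cores. Fed with the landed block certificates of weights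
`14 … 17` and E5′ (`stub_rowZ_of_gds`) they give the double-shuffle leaf `LeafDS` of this line.

References: K. Ihara, M. Kaneko, D. Zagier, Compos. Math. 142 (2006) §2, Conjecture 1
[IharaKanekoZagier2006]; M. Kaneko, M. Noro, K. Tsurumaki, IMA Vol. Math. Appl. 148 (2008).
-/

namespace Summit.KontsevichZagierPeriods.LinRedNormalForm.HoffmanSpanInKZ

open Literature.NumberTheory.Transcendental
open Literature.NumberTheory.Transcendental.LinEDS
open Summit.KontsevichZagierPeriods.FurushoPentagon.KernelModuloPeriodConjecture

/-- **The leaf from a chain of block certificates** (generic twin, line `eds-ds`, of FurushoPentagon's `stub_leaf_of_checkBlocks`,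
lead c5 Stage 2; generic twin for line `eds-ds` of crux stmt-KontsevichZagierPeriods-15044). [cite: IharaKanekoZagier2006, Conjecture 1] -/
theorem stub_leafRows_of_checkBlocks :
    ∀ (k : ℕ) (bl : List (ℕ × ℕ)), 2 ≤ k → bl ≠ [] → (∀ p ∈ bl, p.1 ≤ p.2) →
      bl.head?.map Prod.fst = some 0 → bl.IsChain (fun p q => p.2 = q.1) →
      (∀ p ∈ bl, ∃ names, LinEDS.checkBlock k p.1 p.2 names = true) →
      LinEDS.depthCovered k ((bl.getLast?.map Prod.snd).getD 0) = true →
      ∀ s : List ℕ, MZV.IsAdmissible s → MZV.weight s = k →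
        ∃ b : List ℕ →₀ ℚ, (∀ t ∈ b.support, MZV.IsHoffman t ∧ MZV.weight t = MZV.weight s) ∧ ∀ (R : Type) [CommRing R] [Algebra ℚ R] (φ : NCSeries Bool R), NCSeries.IsGroupLike φ → φ [true] = 0 → (∀ nm : List ℕ × List ℕ, LinEDS.validName k nm = true → LinEDS.evalZ φ (LinEDS.rowZ nm) = 0) → φ (MZV.binaryWord s) = b.sum (fun t q => q • φ (MZV.binaryWord t)) := by
  classical
  intro k bl hk hne hle hhead hchain hblocks hcov s hs hw
  -- choose the names of each block
  choose nm hnm using hblocks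
  set B := bl.length with hB
  let lo : Fin B → ℕ := fun β => (bl.get β).1
  let Dp : Fin B → ℕ := fun β => (bl.get β).2
  let names : Fin B → List (List ℕ × List ℕ) := fun β => nm (bl.get β) (List.get_mem _ _)
  have hchk : ∀ β, LinEDS.checkBlock k (lo β) (Dp β) (names β) = true := fun β => hnm _ _
  let C : Fin B → List ℕ := fun β => LinEDS.colsDepth k (lo β) (Dp β)
  let nb : Fin B → ℕ := fun β => (C β).length
  have hlen : ∀ β, (C β).length = (names β).length := fun β => ((blocksE13_checkBlock (hchk β)).1).symm
  -- positions, names and columns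
  let ν : (Σ β : Fin B, Fin (nb β)) → List ℕ × List ℕ := fun i => (names i.1).get (Fin.cast (hlen i.1) i.2)
  let col : (Σ β : Fin B, Fin (nb β)) → ℕ := fun j => (C j.1).get j.2
  have hvalid : ∀ i, LinEDS.validName k (ν i) = true :=
    fun i => (blocksE13_checkBlock (hchk i.1)).2.1 _ (List.get_mem _ _)
  have hcolC : ∀ j, col j ∈ C j.1 := fun j => List.get_mem _ _
  have hcolmem : ∀ j, col j ∈ LinEDS.cols k := fun j => (blocksE13_mem_colsDepth.mp (hcolC j)).1
  obtain ⟨-, hcols, -, -⟩ := stub_cols_spec k hk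
  -- every column lies in a block
  have hhead' : (bl.head hne).1 = 0 := by
    rw [List.head?_eq_some_head hne] at hhead
    simpa using hhead
  have hlast' : (bl.getLast?.map Prod.snd).getD 0 = (bl.getLast hne).2 := by
    rw [List.getLast?_eq_some_getLast hne]; rfl
  rw [hlast'] at hcov
  have hcolsurj : ∀ c ∈ LinEDS.cols k, ∃ j, col j = c := by
    intro c hc
    have hd1 : 1 ≤ LinEDS.popc k c := blocksE13_popc_pos (by omega) ((hcols c).mp hc).2.1
    have hd2 : LinEDS.popc k c ≤ (bl.getLast hne).2 := by
      simp only [LinEDS.depthCovered, List.all_eq_true, Nat.ble_eq] at hcov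
      exact hcov c hc
    obtain ⟨β, h1, h2⟩ := blocksE13_chain_cover bl hne hchain (LinEDS.popc k c) (by omega) hd2
    have hcC : c ∈ C β := blocksE13_mem_colsDepth.mpr ⟨hc, h1, h2⟩
    obtain ⟨y, hy⟩ := List.mem_iff_get.mp hcC
    exact ⟨⟨β, y⟩, hy⟩
  -- odd determinant, by blocks
  have hdet : Odd (Matrix.of fun i j => LinEDS.entry k (ν i) (col j)).det := by
    refine stub_blockDet_odd B nb _ (fun i j hij => ?_) (fun β => ?_)
    · -- above the diagonal blocks the bit vanishes, so the entry is even
      rw [Matrix.of_apply, ← Int.not_odd_iff_even,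
        ← (stub_rowBits_parity k _ (hvalid i)).1 (col j) (hcolmem j)]
      have hdepth : Dp i.1 < LinEDS.popc k (col j) :=
        lt_of_le_of_lt (blocksE13_chain_mono bl hchain hle i.1 j.1 hij)
          (blocksE13_mem_colsDepth.mp (hcolC j)).2.1
      have hhigher : col j ∈ LinEDS.colsDepth k (Dp i.1) k :=
        blocksE13_mem_colsDepth.mpr ⟨hcolmem j, hdepth, blocksE13_popc_le _ _⟩
      have hzero := (blocksE13_checkBlock (hchk i.1)).2.2.1 _ (List.get_mem _ (Fin.cast (hlen i.1) i.2))
      have hbit := congrArg (·.testBit (col j)) hzero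
      simp only [Nat.testBit_land, Nat.zero_testBit,
        (blocksE13_testBit_maskOf _ _).mpr hhigher, Bool.and_true] at hbit
      show ¬ (LinEDS.rowBits k (ν i)).testBit (col j) = true
      rw [hbit]; exact Bool.false_ne_true
    · -- the diagonal block
      exact blocksE13_diag_odd hk (hchk β) (hlen β)
  exact stub_leafRows_of_oddDet k _ ν col hk hvalid hcolmem hcolsurj hdet s hs hw

/-- **The leaf from a chain of grouped block certificates** (generic twin, line `eds-ds`, of FurushoPentagon's
`stub_leaf_of_checkBlocksG`, lead c6; generic twin for line `eds-ds` of crux stmt-KontsevichZagierPeriods-15044):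
consecutive depth blocks `(0, D₁], (D₁, D₂], …` covering every column, each certified by
`LinEDS.checkBlockG` ⇒ the Hoffman expansion of every admissible index of weight `k` at every group-like series with `c_y = 0` on which the valid rows vanish. [cite: IharaKanekoZagier2006, Conjecture 1] -/
theorem stub_leafRows_of_checkBlocksG :
    ∀ (k : ℕ) (bl : List (ℕ × ℕ)), 2 ≤ k → bl ≠ [] → (∀ p ∈ bl, p.1 ≤ p.2) →
      bl.head?.map Prod.fst = some 0 → bl.IsChain (fun p q => p.2 = q.1) →
      (∀ p ∈ bl, ∃ groups, LinEDS.checkBlockG k p.1 p.2 groups = true) →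
      LinEDS.depthCovered k ((bl.getLast?.map Prod.snd).getD 0) = true →
      ∀ s : List ℕ, MZV.IsAdmissible s → MZV.weight s = k →
        ∃ b : List ℕ →₀ ℚ, (∀ t ∈ b.support, MZV.IsHoffman t ∧ MZV.weight t = MZV.weight s) ∧ ∀ (R : Type) [CommRing R] [Algebra ℚ R] (φ : NCSeries Bool R), NCSeries.IsGroupLike φ → φ [true] = 0 → (∀ nm : List ℕ × List ℕ, LinEDS.validName k nm = true → LinEDS.evalZ φ (LinEDS.rowZ nm) = 0) → φ (MZV.binaryWord s) = b.sum (fun t q => q • φ (MZV.binaryWord t)) := by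
  classical
  intro k bl hk hne hle hhead hchain hblocks hcov s hs hw
  choose nm hnm using hblocks
  set B := bl.length with hB
  let lo : Fin B → ℕ := fun β => (bl.get β).1
  let Dp : Fin B → ℕ := fun β => (bl.get β).2
  let groups : Fin B → List (List (List ℕ × List ℕ)) := fun β => nm (bl.get β) (List.get_mem _ _)
  have hchk : ∀ β, LinEDS.checkBlockG k (lo β) (Dp β) (groups β) = true := fun β => hnm _ _
  let C : Fin B → List ℕ := fun β => LinEDS.colsDepth k (lo β) (Dp β)
  let nb : Fin B → ℕ := fun β => (C β).length
  have hlen : ∀ β, (C β).length = (groups β).length :=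
    fun β => ((blocksG_checkBlockG (hchk β)).1).symm
  -- positions, groups and columns
  let ν : (Σ β : Fin B, Fin (nb β)) → List (List ℕ × List ℕ) :=
    fun i => (groups i.1).get (Fin.cast (hlen i.1) i.2)
  let col : (Σ β : Fin B, Fin (nb β)) → ℕ := fun j => (C j.1).get j.2
  have hvalid : ∀ i, ∀ μ ∈ ν i, LinEDS.validName k μ = true :=
    fun i => (blocksG_checkBlockG (hchk i.1)).2.1 _ (List.get_mem _ _)
  have hcolC : ∀ j, col j ∈ C j.1 := fun j => List.get_mem _ _
  have hcolmem : ∀ j, col j ∈ LinEDS.cols k := fun j => (blocksE13_mem_colsDepth.mp (hcolC j)).1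
  obtain ⟨-, hcols, -, -⟩ := stub_cols_spec k hk
  -- every column lies in a block
  have hhead' : (bl.head hne).1 = 0 := by
    rw [List.head?_eq_some_head hne] at hhead
    simpa using hhead
  have hlast' : (bl.getLast?.map Prod.snd).getD 0 = (bl.getLast hne).2 := by
    rw [List.getLast?_eq_some_getLast hne]; rfl
  rw [hlast'] at hcov
  have hcolsurj : ∀ c ∈ LinEDS.cols k, ∃ j, col j = c := by
    intro c hc
    have hd1 : 1 ≤ LinEDS.popc k c := blocksE13_popc_pos (by omega) ((hcols c).mp hc).2.1
    have hd2 : LinEDS.popc k c ≤ (bl.getLast hne).2 := by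
      simp only [LinEDS.depthCovered, List.all_eq_true, Nat.ble_eq] at hcov
      exact hcov c hc
    obtain ⟨β, h1, h2⟩ := blocksE13_chain_cover bl hne hchain (LinEDS.popc k c) (by omega) hd2
    have hcC : c ∈ C β := blocksE13_mem_colsDepth.mpr ⟨hc, h1, h2⟩
    obtain ⟨y, hy⟩ := List.mem_iff_get.mp hcC
    exact ⟨⟨β, y⟩, hy⟩
  -- odd determinant, by blocks
  have hdet : Odd (Matrix.of fun i j => LinEDS.entryG k (ν i) (col j)).det := by
    refine stub_blockDet_odd B nb _ (fun i j hij => ?_) (fun β => ?_)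
    · -- above the diagonal blocks the bit vanishes, so the group entry is even
      rw [Matrix.of_apply, ← Int.not_odd_iff_even,
        ← blocksG_rowBitsG_parity (hvalid i) (hcolmem j)]
      have hdepth : Dp i.1 < LinEDS.popc k (col j) :=
        lt_of_le_of_lt (blocksE13_chain_mono bl hchain hle i.1 j.1 hij)
          (blocksE13_mem_colsDepth.mp (hcolC j)).2.1
      have hhigher : col j ∈ LinEDS.colsDepth k (Dp i.1) k :=
        blocksE13_mem_colsDepth.mpr ⟨hcolmem j, hdepth, blocksE13_popc_le _ _⟩
      have hzero := (blocksG_checkBlockG (hchk i.1)).2.2.1 _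
        (List.get_mem _ (Fin.cast (hlen i.1) i.2))
      have hbit := congrArg (·.testBit (col j)) hzero
      simp only [Nat.testBit_land, Nat.zero_testBit,
        (blocksE13_testBit_maskOf _ _).mpr hhigher, Bool.and_true] at hbit
      show ¬ (LinEDS.rowBitsG k (ν i)).testBit (col j) = true
      rw [hbit]; exact Bool.false_ne_true
    · exact blocksG_diag_odd hk (hchk β) (hlen β)
  exact stub_leafRows_of_oddDetSum k _ ν col hk hvalid hcolmem hcolsurj hdet s hs hw

/-- **Mixed chains**: every block certified EITHER by the plain check `LinEDS.checkBlock` OR by the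
grouped check `LinEDS.checkBlockG` ⇒ the generic Hoffman expansion in weight `k` (plain certificates are
grouped ones with singleton groups, `LinEDS.checkBlockG_singletons`). [cite: IharaKanekoZagier2006, Conjecture 1] -/
theorem leafRows_of_checkBlocks_mixed (k : ℕ) (bl : List (ℕ × ℕ)) (hk : 2 ≤ k) (hne : bl ≠ [])
    (hle : ∀ p ∈ bl, p.1 ≤ p.2) (hhead : bl.head?.map Prod.fst = some 0)
    (hchain : bl.IsChain (fun p q => p.2 = q.1))
    (hblocks : ∀ p ∈ bl, (∃ names, LinEDS.checkBlock k p.1 p.2 names = true) ∨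
      (∃ groups, LinEDS.checkBlockG k p.1 p.2 groups = true))
    (hcov : LinEDS.depthCovered k ((bl.getLast?.map Prod.snd).getD 0) = true)
    (s : List ℕ) (hs : MZV.IsAdmissible s) (hw : MZV.weight s = k) :
    ∃ b : List ℕ →₀ ℚ, (∀ t ∈ b.support, MZV.IsHoffman t ∧ MZV.weight t = MZV.weight s) ∧ ∀ (R : Type) [CommRing R] [Algebra ℚ R] (φ : NCSeries Bool R), NCSeries.IsGroupLike φ → φ [true] = 0 → (∀ nm : List ℕ × List ℕ, LinEDS.validName k nm = true → LinEDS.evalZ φ (LinEDS.rowZ nm) = 0) → φ (MZV.binaryWord s) = b.sum (fun t q => q • φ (MZV.binaryWord t)) := by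
  refine stub_leafRows_of_checkBlocksG k bl hk hne hle hhead hchain (fun p hp => ?_) hcov s hs hw
  rcases hblocks p hp with ⟨names, h⟩ | h
  · exact ⟨names.map fun ν => [ν], by rw [LinEDS.checkBlockG_singletons]; exact h⟩
  · exact h

/-- **The leaf from a chain of grouped, compacted block certificates** (generic twin, line `eds-ds`, of FurushoPentagon's
`stub_leaf_of_checkBlocksGC`, lead c6; generic twin for line `eds-ds` of crux stmt-KontsevichZagierPeriods-15044):
consecutive depth blocks `(0, D₁], (D₁, D₂], …` covering every column, each certified by
`LinEDS.checkBlockGC` at some width `W'` with enough fuel (`2^(k-1) ≤ W'(f+1)`, so the fold is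
complete) ⇒ the Hoffman expansion of every admissible index of weight `k` at every group-like series with `c_y = 0` on which the valid rows vanish. [cite: IharaKanekoZagier2006, Conjecture 1] -/
theorem stub_leafRows_of_checkBlocksGC :
    ∀ (k : ℕ) (bl : List (ℕ × ℕ)), 2 ≤ k → bl ≠ [] → (∀ p ∈ bl, p.1 ≤ p.2) →
      bl.head?.map Prod.fst = some 0 → bl.IsChain (fun p q => p.2 = q.1) →
      (∀ p ∈ bl, ∃ (W' f : ℕ) (L : List ℕ) (groups : List (List (List ℕ × List ℕ))),
        2 ^ (k - 1) ≤ W' * (f + 1) ∧ LinEDS.checkBlockGC k p.1 p.2 W' f L groups = true) →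
      LinEDS.depthCovered k ((bl.getLast?.map Prod.snd).getD 0) = true →
      ∀ s : List ℕ, MZV.IsAdmissible s → MZV.weight s = k →
        ∃ b : List ℕ →₀ ℚ, (∀ t ∈ b.support, MZV.IsHoffman t ∧ MZV.weight t = MZV.weight s) ∧ ∀ (R : Type) [CommRing R] [Algebra ℚ R] (φ : NCSeries Bool R), NCSeries.IsGroupLike φ → φ [true] = 0 → (∀ nm : List ℕ × List ℕ, LinEDS.validName k nm = true → LinEDS.evalZ φ (LinEDS.rowZ nm) = 0) → φ (MZV.binaryWord s) = b.sum (fun t q => q • φ (MZV.binaryWord t)) := by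
  classical
  intro k bl hk hne hle hhead hchain hblocks hcov s hs hw
  choose Wq fq Lq nm hfuel hnm using hblocks
  set B := bl.length with hB
  let lo : Fin B → ℕ := fun β => (bl.get β).1
  let Dp : Fin B → ℕ := fun β => (bl.get β).2
  have hmemβ : ∀ β : Fin B, bl.get β ∈ bl := fun β => List.get_mem _ _
  let W' : Fin B → ℕ := fun β => Wq (bl.get β) (hmemβ β)
  let fu : Fin B → ℕ := fun β => fq (bl.get β) (hmemβ β)
  let L : Fin B → List ℕ := fun β => Lq (bl.get β) (hmemβ β)
  let groups : Fin B → List (List (List ℕ × List ℕ)) := fun β => nm (bl.get β) (hmemβ β)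
  have hchk : ∀ β, LinEDS.checkBlockGC k (lo β) (Dp β) (W' β) (fu β) (L β) (groups β) = true :=
    fun β => hnm _ _
  have hfu : ∀ β, 2 ^ (k - 1) ≤ W' β * (fu β + 1) := fun β => hfuel _ _
  let C : Fin B → List ℕ := fun β => LinEDS.colsDepth k (lo β) (Dp β)
  let nb : Fin B → ℕ := fun β => (C β).length
  have hlen : ∀ β, (C β).length = (groups β).length := fun β => ((blocksGC_checkBlockGC (hchk β)).1).symm
  have hlenL : ∀ β, (C β).length = (L β).length := fun β => ((blocksGC_checkBlockGC (hchk β)).2.1).symm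
  have hmemL : ∀ β, ∀ c, c ∈ L β ↔ c ∈ C β := fun β =>
    (blocksGC_mem_L hk (blocksGC_checkBlockGC (hchk β)).2.2.1 (blocksGC_checkBlockGC (hchk β)).2.2.2.1
      (hlenL β).symm).1
  -- positions, groups and columns (columns through the certificate's lists)
  let ν : (Σ β : Fin B, Fin (nb β)) → List (List ℕ × List ℕ) :=
    fun i => (groups i.1).get (Fin.cast (hlen i.1) i.2)
  let col : (Σ β : Fin B, Fin (nb β)) → ℕ := fun j => (L j.1).get (Fin.cast (hlenL j.1) j.2)
  have hvalid : ∀ i, ∀ μ ∈ ν i, LinEDS.validName k μ = true :=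
    fun i => (blocksGC_checkBlockGC (hchk i.1)).2.2.2.2.2.1 _ (List.get_mem _ _)
  have hcolC : ∀ j, col j ∈ C j.1 := fun j => (hmemL j.1 _).mp (List.get_mem _ _)
  have hcolmem : ∀ j, col j ∈ LinEDS.cols k := fun j => (blocksE13_mem_colsDepth.mp (hcolC j)).1
  obtain ⟨-, hcols, -, -⟩ := stub_cols_spec k hk
  -- every column lies in a block
  have hhead' : (bl.head hne).1 = 0 := by
    rw [List.head?_eq_some_head hne] at hhead
    simpa using hhead
  have hlast' : (bl.getLast?.map Prod.snd).getD 0 = (bl.getLast hne).2 := by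
    rw [List.getLast?_eq_some_getLast hne]; rfl
  rw [hlast'] at hcov
  have hcolsurj : ∀ c ∈ LinEDS.cols k, ∃ j, col j = c := by
    intro c hc
    have hd1 : 1 ≤ LinEDS.popc k c := blocksE13_popc_pos (by omega) ((hcols c).mp hc).2.1
    have hd2 : LinEDS.popc k c ≤ (bl.getLast hne).2 := by
      simp only [LinEDS.depthCovered, List.all_eq_true, Nat.ble_eq] at hcov
      exact hcov c hc
    obtain ⟨β, h1, h2⟩ := blocksE13_chain_cover bl hne hchain (LinEDS.popc k c) (by omega) hd2
    have hcC : c ∈ C β := blocksE13_mem_colsDepth.mpr ⟨hc, h1, h2⟩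
    obtain ⟨y, hy⟩ := List.mem_iff_get.mp ((hmemL β c).mpr hcC)
    exact ⟨⟨β, Fin.cast (hlenL β).symm y⟩, by simpa [col] using hy⟩
  -- odd determinant, by blocks
  have hdet : Odd (Matrix.of fun i j => LinEDS.entryG k (ν i) (col j)).det := by
    refine stub_blockDet_odd B nb _ (fun i j hij => ?_) (fun β => ?_)
    · -- above the diagonal blocks the bit vanishes, so the group entry is even
      rw [Matrix.of_apply, ← Int.not_odd_iff_even,
        ← blocksG_rowBitsG_parity (hvalid i) (hcolmem j)]
      have hdepth : Dp i.1 < LinEDS.popc k (col j) :=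
        lt_of_le_of_lt (blocksE13_chain_mono bl hchain hle i.1 j.1 hij)
          (blocksE13_mem_colsDepth.mp (hcolC j)).2.1
      have hhigher : col j ∈ LinEDS.colsDepth k (Dp i.1) k :=
        blocksE13_mem_colsDepth.mpr ⟨hcolmem j, hdepth, blocksE13_popc_le _ _⟩
      have hzero := (blocksGC_checkBlockGC (hchk i.1)).2.2.2.2.2.2.1 _
        (List.get_mem _ (Fin.cast (hlen i.1) i.2))
      have hbit := congrArg (·.testBit (col j)) hzero
      simp only [Nat.testBit_land, Nat.zero_testBit,
        (blocksE13_testBit_maskOf _ _).mpr hhigher, Bool.and_true] at hbit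
      show ¬ (LinEDS.rowBitsG k (ν i)).testBit (col j) = true
      rw [hbit]; exact Bool.false_ne_true
    · exact blocksGC_diag_odd hk (hchk β) (hfu β) (hlen β) (hlenL β)
  exact stub_leafRows_of_oddDetSum k _ ν col hk hvalid hcolmem hcolsurj hdet s hs hw

end Summit.KontsevichZagierPeriods.LinRedNormalForm.HoffmanSpanInKZ
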